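import Literature.NumberTheory.Automorphic.Liu2021.Def411AsPrinted
import HarnessLib

/-!
# Transport of «admissible» / «smooth» ([Liu2021, Def. 4.11]; Bernstein–Zelevinsky §2.1) along
# equivariant linear isomorphisms and along continuous open homomorphisms of groups

Topic `Literature/NumberTheory/Automorphic/Liu2021`, namespace `Literature.NumberTheory.Automorphic.Liu2021`
(API of the adjectives `IsAdmissibleRep`, `IsSmoothRep`, `fixedSubmodule` of `Def411AsPrinted` and of
`IsOpenCompact` of `Thm418AsPrinted`).  PROOF-ONLY file (theorems only, no definition, no named fact; net
Literature debt 0).  Cell `hodgecm-mathlib` (fan A, rung A-IV, line `a4-liu411`, binder `h411`): GENERIC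
transport lemmas for the stub `stub_rhoAtLine_isAdmissibleRep_of_lemD1AsPrinted` (the KEY's steps (5a)
«equivariant isomorphism» and (5d) «pull-back along `ι`»; the Liu-specific comparison maps live in
`Def411WeilCarriersAtLine` / `…AdmissibleOfLemD1`).

WHAT IS PROVED (`ρ : Representation ℂ G V`, `G` a topological group):

* §1 pull-back along a homomorphism `ι : G′ →* G`: `fixedSubmodule_comp` (`(ρ ∘ ι)`-fixed vectors of
  `K′ ≤ G′` = `ρ`-fixed vectors of `ι(K′)`), `isOpenCompact_map` (`ι` continuous and OPEN carries open
  compact subgroups to open compact subgroups), **`isAdmissibleRep_comp_of_isOpenMap`** (`ρ` admissible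
  ⇒ `ρ ∘ ι` admissible for `ι` continuous open), `isSmoothRep_comp_of_continuous`;
* §2 equivariant linear isomorphisms `e : V ≃ₗ[ℂ] W`, `e(ρ(g)v) = ρ′(g)e(v)`:
  `map_fixedSubmodule_eq_of_linearEquiv`, **`isAdmissibleRep_iff_of_linearEquiv`**,
  `isSmoothRep_iff_of_linearEquiv` (irreducibility is transported by the existing chain of
  `Def411WeilCarriersAtLine`, not repeated here);
* §3 isomorphisms of topological groups `φ : G′ ≃* G` continuous in both directions:
  **`isAdmissibleRep_comp_mulEquiv_iff`**, `isSmoothRep_comp_mulEquiv_iff`.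

All statements are the standard functoriality of [BernsteinZelevinsky1976, §2.1] («smooth», «admissible»
are preserved by isomorphisms of representations and by restriction along open embeddings of groups);
[Liu2021, Def. 4.11] uses them tacitly when passing between `⊗′_v ω(μ_v, ε_v, χ_v)` and its models.

RELATION TO THE TREE (not restated here): for the Bernstein–Zelevinsky predicate `Representation.IsAdmissible`
(smooth AND finite fixed vectors under compact `OpenSubgroup`s) the equivariant-isomorphism transports are
`Representation.isAdmissible_iff_of_equivariant` / `Representation.IsAdmissible.of_equivariant_mulEquiv` of
`Literature/RepresentationTheory/TwistedCoinvariantsCentralCharacterQuotient.lean`; the present file treats the two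
SEPARATE adjectives `IsAdmissibleRep` (finiteness only, over `IsOpenCompact` subgroups) and `IsSmoothRep` of
`Def411AsPrinted` — the currency of `Def411AsPrinted` / `Prop413AsPrinted` and of the `a4-liu411` stubs — which are
linked to `Representation.IsAdmissible` by `isAdmissible_of_isSmoothRep_of_isAdmissibleRep` and
`isSmoothRep_and_isAdmissibleRep_of_isAdmissible` (`Prop413MultLeOneOfAsPrinted.lean`); §1 (pull-back along a
continuous OPEN homomorphism that need not be injective or surjective) has no counterpart there.

## References

* [Liu2021] Y. Liu, *Fourier–Jacobi cycles and arithmetic relative trace formula*, Camb. J. Math. 9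
  (2021), Def. 4.11.
* [BernsteinZelevinsky1976] I. N. Bernstein, A. V. Zelevinsky, *Representations of the group GL(n, F)
  where F is a non-archimedean local field*, Russian Math. Surveys 31 (1976), §2.1.
-/

noncomputable section

namespace Literature.NumberTheory.Automorphic.Liu2021

/-! ## §1. Pull-back along a homomorphism of groups -/

section Comp

variable {G G' V : Type} [Group G] [Group G'] [AddCommGroup V] [Module ℂ V]
  (ρ : Representation ℂ G V) (ι : G' →* G)

/-- **`(ρ ∘ ι)`-fixed vectors of `K′ ≤ G′` are the `ρ`-fixed vectors of `ι(K′) ≤ G`.** [cite: BernsteinZelevinsky1976, §2.1] -/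
theorem fixedSubmodule_comp (K' : Subgroup G') :
    fixedSubmodule (ρ.comp ι) K' = fixedSubmodule ρ (K'.map ι) := by
  ext v
  simp only [mem_fixedSubmodule_iff, Subgroup.mem_map]
  constructor
  · rintro h _ ⟨k, hk, rfl⟩
    exact h k hk
  · intro h k hk
    exact h (ι k) ⟨k, hk, rfl⟩

variable [TopologicalSpace G] [TopologicalSpace G']

omit [AddCommGroup V] [Module ℂ V] in
/-- A continuous OPEN homomorphism carries open compact subgroups to open compact subgroups (image of an
open set under an open map, of a compact set under a continuous map). [cite: BernsteinZelevinsky1976, §2.1] -/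
theorem isOpenCompact_map {ι : G' →* G} (hιc : Continuous ι) (hιo : IsOpenMap ι) {K' : Subgroup G'}
    (hK' : IsOpenCompact K') : IsOpenCompact (K'.map ι) :=
  ⟨by rw [Subgroup.coe_map]; exact hιo _ hK'.1, by rw [Subgroup.coe_map]; exact hK'.2.image hιc⟩

/-- **Admissibility pulls back along a continuous open homomorphism** `ι : G′ → G`: if every open compact
`K ≤ G` has finite-dimensional `ρ`-fixed vectors then so does every open compact `K′ ≤ G′` for `ρ ∘ ι`
(its fixed vectors are those of the open compact `ι(K′)`). Step (5d) of the `a4-liu411` KEY for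
`stub_rhoAtLine_isAdmissibleRep_of_lemD1AsPrinted`. [cite: BernsteinZelevinsky1976, §2.1] [cite: Liu2021, Def. 4.11] -/
theorem isAdmissibleRep_comp_of_isOpenMap {ι : G' →* G} (hιc : Continuous ι) (hιo : IsOpenMap ι)
    (h : IsAdmissibleRep ρ) : IsAdmissibleRep (ρ.comp ι) := fun K' hK' => by
  rw [fixedSubmodule_comp]
  exact h _ (isOpenCompact_map hιc hιo hK')

/-- **Smoothness pulls back along a continuous homomorphism**: the stabiliser of `v` for `ρ ∘ ι` contains
the preimage of an open subgroup fixing `v`. [cite: BernsteinZelevinsky1976, §2.1] [cite: Liu2021, Def. 4.11] -/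
theorem isSmoothRep_comp_of_continuous {ι : G' →* G} (hιc : Continuous ι) (h : IsSmoothRep ρ) :
    IsSmoothRep (ρ.comp ι) := fun v => by
  obtain ⟨S, hSo, hS⟩ := h v
  exact ⟨S.comap ι, hSo.preimage hιc, fun k hk => hS (ι k) hk⟩

end Comp

/-! ## §2. Equivariant linear isomorphisms -/

section LinearEquiv

variable {G V W : Type} [Group G] [AddCommGroup V] [Module ℂ V] [AddCommGroup W] [Module ℂ W]
  (ρ : Representation ℂ G V) (ρ' : Representation ℂ G W) (e : V ≃ₗ[ℂ] W)
  (he : ∀ (g : G) (v : V), e (ρ g v) = ρ' g (e v))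

include he in
/-- Equivariance passes to the inverse isomorphism. [cite: BernsteinZelevinsky1976, §2.1] -/
theorem symm_apply_rep_of_equivariant (g : G) (w : W) : e.symm (ρ' g w) = ρ g (e.symm w) :=
  e.injective (by rw [he, e.apply_symm_apply, e.apply_symm_apply])

include he in
/-- **An equivariant linear isomorphism carries `K`-fixed vectors onto `K`-fixed vectors.**
[cite: BernsteinZelevinsky1976, §2.1] -/
theorem map_fixedSubmodule_eq_of_linearEquiv (K : Subgroup G) :
    (fixedSubmodule ρ K).map (e : V →ₗ[ℂ] W) = fixedSubmodule ρ' K := by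
  ext w
  constructor
  · rintro ⟨v, hv, rfl⟩
    rw [SetLike.mem_coe, mem_fixedSubmodule_iff] at hv
    rw [mem_fixedSubmodule_iff]
    intro k hk
    rw [LinearEquiv.coe_coe, ← he, hv k hk]
  · intro hw
    rw [mem_fixedSubmodule_iff] at hw
    refine ⟨e.symm w, ?_, e.apply_symm_apply w⟩
    rw [SetLike.mem_coe, mem_fixedSubmodule_iff]
    intro k hk
    rw [← symm_apply_rep_of_equivariant ρ ρ' e he, hw k hk]

variable [TopologicalSpace G]

include he in
/-- **Admissibility is invariant under equivariant linear isomorphisms** (one direction).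
[cite: BernsteinZelevinsky1976, §2.1] [cite: Liu2021, Def. 4.11] -/
theorem isAdmissibleRep_of_linearEquiv (h : IsAdmissibleRep ρ) : IsAdmissibleRep ρ' := fun K hK => by
  rw [← map_fixedSubmodule_eq_of_linearEquiv ρ ρ' e he K]
  haveI := h K hK
  infer_instance

include he in
/-- **Admissibility is invariant under equivariant linear isomorphisms.** Step (5a) of the `a4-liu411`
KEY (the comparison isomorphisms of the irreducibility chain transport admissibility as well).
[cite: BernsteinZelevinsky1976, §2.1] [cite: Liu2021, Def. 4.11] -/
theorem isAdmissibleRep_iff_of_linearEquiv : IsAdmissibleRep ρ ↔ IsAdmissibleRep ρ' :=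
  ⟨isAdmissibleRep_of_linearEquiv ρ ρ' e he,
    isAdmissibleRep_of_linearEquiv ρ' ρ e.symm (symm_apply_rep_of_equivariant ρ ρ' e he)⟩

include he in
/-- **Smoothness is invariant under equivariant linear isomorphisms** (one direction: an open subgroup
fixing `e⁻¹ w` fixes `w`). [cite: BernsteinZelevinsky1976, §2.1] [cite: Liu2021, Def. 4.11] -/
theorem isSmoothRep_of_linearEquiv (h : IsSmoothRep ρ) : IsSmoothRep ρ' := fun w => by
  obtain ⟨S, hSo, hS⟩ := h (e.symm w)
  refine ⟨S, hSo, fun k hk => ?_⟩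
  have h1 := congrArg e (hS k hk)
  rwa [he, e.apply_symm_apply] at h1

include he in
/-- **Smoothness is invariant under equivariant linear isomorphisms.** [cite: BernsteinZelevinsky1976, §2.1] [cite: Liu2021, Def. 4.11] -/
theorem isSmoothRep_iff_of_linearEquiv : IsSmoothRep ρ ↔ IsSmoothRep ρ' :=
  ⟨isSmoothRep_of_linearEquiv ρ ρ' e he,
    isSmoothRep_of_linearEquiv ρ' ρ e.symm (symm_apply_rep_of_equivariant ρ ρ' e he)⟩

end LinearEquiv

/-! ## §3. Isomorphisms of topological groups -/

section MulEquiv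

variable {G G' V : Type} [Group G] [Group G'] [TopologicalSpace G] [TopologicalSpace G']
  [AddCommGroup V] [Module ℂ V] (ρ : Representation ℂ G V) (φ : G' ≃* G)
  (hφ : Continuous φ) (hφ' : Continuous φ.symm)

include hφ hφ' in
/-- **Admissibility is invariant under isomorphisms of topological groups** `φ : G′ ≅ G` (continuous with
continuous inverse): `ρ ∘ φ` is admissible iff `ρ` is (`φ` and `φ⁻¹` are continuous open homomorphisms;
`ρ = (ρ ∘ φ) ∘ φ⁻¹`). [cite: BernsteinZelevinsky1976, §2.1] [cite: Liu2021, Def. 4.11] -/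
theorem isAdmissibleRep_comp_mulEquiv_iff :
    IsAdmissibleRep (ρ.comp φ.toMonoidHom) ↔ IsAdmissibleRep ρ := by
  have hoφ : IsOpenMap φ := (Homeomorph.mk φ.toEquiv hφ hφ').isOpenMap
  have hoφ' : IsOpenMap φ.symm := (Homeomorph.mk φ.toEquiv hφ hφ').symm.isOpenMap
  refine ⟨fun h => ?_, isAdmissibleRep_comp_of_isOpenMap ρ hφ hoφ⟩
  have h' := isAdmissibleRep_comp_of_isOpenMap (ρ.comp φ.toMonoidHom) (ι := φ.symm.toMonoidHom) hφ' hoφ' h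
  have hcomp : (ρ.comp φ.toMonoidHom).comp φ.symm.toMonoidHom = ρ := by
    ext g v
    simp only [MonoidHom.comp_apply, MulEquiv.coe_toMonoidHom, MulEquiv.apply_symm_apply]
  rwa [hcomp] at h'

include hφ hφ' in
/-- **Smoothness is invariant under isomorphisms of topological groups.** [cite: BernsteinZelevinsky1976, §2.1] [cite: Liu2021, Def. 4.11] -/
theorem isSmoothRep_comp_mulEquiv_iff :
    IsSmoothRep (ρ.comp φ.toMonoidHom) ↔ IsSmoothRep ρ := by
  refine ⟨fun h => ?_, isSmoothRep_comp_of_continuous ρ hφ⟩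
  have h' := isSmoothRep_comp_of_continuous (ρ.comp φ.toMonoidHom) (ι := φ.symm.toMonoidHom) hφ' h
  have hcomp : (ρ.comp φ.toMonoidHom).comp φ.symm.toMonoidHom = ρ := by
    ext g v
    simp only [MonoidHom.comp_apply, MulEquiv.coe_toMonoidHom, MulEquiv.apply_symm_apply]
  rwa [hcomp] at h'

end MulEquiv

end Literature.NumberTheory.Automorphic.Liu2021

end
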